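import Literature.NumberTheory.LFunctions.ThetaChainFreeCheck
import HarnessLib

/-!
# Schoenfeld's `θ`-bound on `[599, 10⁸]` by kernel computation: data-free run, chunk 25 of 35

Topic: `Literature/NumberTheory/LFunctions`. Pure proof file (a kernel computation; nothing is
asserted, no definition). The theorems below evaluate `ThetaChain.runFree` — together `150000`
data-free steps of the certified `θ`-chain (`ThetaChain.stepFree`, `ThetaChainFreeCheck.lean`: the
next prime found and certified by two gcds with the primorials of the odd primes `≤ 2999` and in
`(2999, 10007]`, the enclosures of `log p` and `θ(p)`, and the two comparisons behind
`|θ(x) − x| ≤ √x log² x/(8π)`) — from the state at the prime `71397713` to the state at the prime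
`74111633`. Soundness: `ThetaChain.runFree_sound`; assembly of the 35 chunks: `ThetaUpTo1e8.lean`.
The expected states were obtained by evaluating a twin of the same function outside the kernel
(validated bit-for-bit on the tree's chunk `ThetaChainRun.xrun14`). Declarations of `5·10⁴` steps
(about `70 s` of kernel time each; the kernel's evaluation is linear within a declaration of this size),
`decide +kernel`, standard axioms only (`maxHeartbeats 0` lifts the deterministic time-out).

## References

* L. Schoenfeld, *Sharper bounds for the Chebyshev functions θ(x) and ψ(x). II*, Math. Comp. 30
  (1976), 337–360, Thm. 10 (6.3). [Schoenfeld1976]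
* J. B. Rosser, L. Schoenfeld, *Approximate formulas for some functions of prime numbers*,
  Illinois J. Math. 6 (1962), 64–94, Thms. 18–19 (`θ`-tables to `10⁸`). [RosserSchoenfeld1962]
-/

namespace Literature.NumberTheory.LFunctions.ThetaChainRun

open ThetaChain

set_option maxHeartbeats 0 in
/-- **Data-free certified `θ`-run, chunk 25a** (steps `3600001`–`3650000` after `8886113`: 50000 primes,
`71397713` to `72298717`). [cite: Schoenfeld1976, Thm. 10 (6.3)] -/
theorem frun25a :
    runFree 50000
      ⟨71397713, 21861944201242998620621291, 21861944201243474310511923, 86303657568706149059331068181579, 86303657568708144570260782404268⟩ =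
    some ⟨72298717, 21877104790468491920975947, 21877104790468967611816999, 87397134761966130599563346078335, 87397134761968149895011353721309⟩ := by
  decide +kernel

set_option maxHeartbeats 0 in
/-- **Data-free certified `θ`-run, chunk 25b** (steps `3650001`–`3700000` after `8886113`: 50000 primes,
`72298717` to `73205183`). [cite: Schoenfeld1976, Thm. 10 (6.3)] -/
theorem frun25b :
    runFree 50000
      ⟨72298717, 21877104790468491920975947, 21877104790468967611816999, 87397134761966130599563346078335, 87397134761968149895011353721309⟩ =
    some ⟨73205183, 21892167813924380861999298, 21892167813924856553790675, 88491367269743789485091868541342, 88491367269745832565105688487751⟩ := by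
  decide +kernel

set_option maxHeartbeats 0 in
/-- **Data-free certified `θ`-run, chunk 25c** (steps `3700001`–`3750000` after `8886113`: 50000 primes,
`73205183` to `74111633`). [cite: Schoenfeld1976, Thm. 10 (6.3)] -/
theorem frun25c :
    runFree 50000
      ⟨73205183, 21892167813924380861999298, 21892167813924856553790675, 88491367269743789485091868541342, 88491367269745832565105688487751⟩ =
    some ⟨74111633, 21907045200888359942809501, 21907045200888835635551218, 89586347850665700843695824306375, 89586347850667767708322972817389⟩ := by
  decide +kernel

end Literature.NumberTheory.LFunctions.ThetaChainRun
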